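import Summits.MatrixMultiplication.MatrixMultiplication.Theorems.CharacteristicContinuityTransferHorizon
import Literature.Computability.AlgebraicComplexity.SmallFormatRank
import Literature.Computability.AlgebraicComplexity.SmallFormatRankProofs
import Literature.Computability.AlgebraicComplexity.TwoByTwoRankLowerBound
import Literature.Computability.AlgebraicComplexity.MatMulM22RankLowerBoundProofs
import HarnessLib

/-!
# CharacteristicContinuityWitnessReach — the LOWER end of the witness window on the characteristic axis
(decomp-mm cell, lens 5 «finite/base range + asymptotic regime + bridge», generation 14)

Helper for the residual item `EventualTransfer` (= K′, stmt-MatrixMultiplication-30790) of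
`route-MatrixMultiplication-CharacteristicContinuity` (cut of record `ω(ℂ) = 2 ↔ W ∧ K′`,
`matrixMultiplication_iff_fast_and_eventualTransfer`).

Generation 10 (`CharacteristicContinuityTransferHorizon`) gave the UPPER end of the range of formats in
which a near-optimal characteristic-`p` witness `R_{𝔽̄_p}(⟨n,n,n⟩) ≤ n^{ω_p+ε}` is of any use to the
bridge (fixed-format Lefschetz transfer): `B n ≤ p` for a transfer horizon `B` (explicitly, `n` of order
`(log log p)^{1/5}` by the arithmetic Nullstellensatz).  This file adds the LOWER end, which is
`p`-independent and comes from the rank floor of square matrix multiplication over EVERY field: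

* `seven_mul_sq_le_four_mul_tensorRank` : `7 n² ≤ 4 · R_K(⟨n,n,n⟩)` for every field `K` and `n ≥ 2`
  (`n = 2`: Winograd / Hopcroft–Kerr `R(⟨2,2,2⟩) = 7`; `n ≥ 3`: Bläser 2003 Thm 14,
  `R(⟨n,n,n⟩) ≥ 2n² + n − 2`).
* `two_lt_of_rank_le_rpow`, `reach_le_of_rank_le_rpow` : if `R_K(⟨n,n,n⟩) ≤ n^τ` (`n ≥ 2`) then
  `τ > 2` and `(7/4)^{1/(τ−2)} ≤ n` — a format certifying the exponent `τ` over ANY field has size at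
  least `(7/4)^{1/(τ−2)}`; in particular no single format certifies `τ = 2` (the quantitative form of
  «the infimum defining ω is not attained at ω = 2»).
* `eventualTransfer_iff_witness_in_window` : for every transfer horizon `B`,
  K′ ↔ for every `ε > 0`, for infinitely many primes `p`, a near-optimal witness exists at a format `n`
  in the TWO-SIDED WINDOW `(7/4)^{1/(ω_p+ε−2)} ≤ n ∧ B n ≤ p`.
* `eventualTransfer_iff_witness_reach_of_fast` : under W (`ω_p ≤ 2 + ε` for all large `p`) the lower
  end is `p`-free: K′ ↔ for every `ε > 0`, infinitely often in `p`, a near-optimal witness at a format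
  `n ≥ (7/4)^{1/(2ε)}` below the horizon.  This is the lens's question answered on this axis: FOR THE
  BRIDGE TO BITE AT PRECISION ε THE FINITE RANGE MUST REACH FORMAT `(7/4)^{1/(2ε)}` — unbounded as
  `ε → 0`, while exact ranks are known only at `⟨2,2,2⟩, ⟨2,2,3⟩, ⟨2,2,4⟩` (next bullet); with the sharper
  printed floors `R(⟨n,n,n⟩) ≥ 3n² − o(n²)` (Landsberg 2014, Massarenti–Raviolo) the base `7/4` becomes
  `3 − o(1)` (not used here: not in the tree for all fields).
* `rank_222_charFree`, `rank_223_charFree`, `rank_224_charFree` : the formats where the horizon is `0` —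
  `R_{𝔽̄_p}(⟨2,2,2⟩) = R_ℂ(⟨2,2,2⟩)` (= 7), `⟨2,2,3⟩` (= 11), `⟨2,2,4⟩` (= 14) for EVERY prime `p`
  (Winograd 1971; Alekseyev 1985; Alekseev–Smirnov 2013 — every-field theorems of the tree), so a
  `SporadicRankDrop` (item 18045) cannot occur at these formats.

Nothing here bears on `ω = 2` itself; the file quantifies how far the certified finite range of the
characteristic axis is from the regime where the bridge acts.
References: [cite: Blaser2003, Theorem 14]; [cite: Winograd1971, Thm 3.1];
[cite: BurgisserClausenShokrollahi1997, Cor. (15.18), Prop. (15.5)]; [cite: Blaser2013, Thm 5.9];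
[cite: Alekseyev1985, main theorem]; [cite: AlekseevSmirnov2013, Thm 1]; [cite: KrickPardoSombra2001, Thm 1].
-/

set_option linter.dupNamespace false -- `MatrixMultiplication.MatrixMultiplication` (summit = problem, D-0017)

noncomputable section

open Filter Finset
open Literature.Computability.AlgebraicComplexity
open Summit.MatrixMultiplication.MatrixMultiplication.Theses.CharacteristicContinuity
open Summit.MatrixMultiplication.MatrixMultiplication.Theorems.CharacteristicContinuityTransfer
open Summit.MatrixMultiplication.MatrixMultiplication.Theorems.CharacteristicContinuityFixedFormat
open Summit.MatrixMultiplication.MatrixMultiplication.Theorems.CharacteristicContinuityEventualTransfer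
open Summit.MatrixMultiplication.MatrixMultiplication.Theorems.CharacteristicContinuityTransferHorizon

namespace Summit.MatrixMultiplication.MatrixMultiplication.Theorems.CharacteristicContinuityWitnessReach

/-! ## 1. The rank floor of square matrix multiplication over every field -/

/-- `7 n² ≤ 4 R_K(⟨n,n,n⟩)` for every field `K` and every `n ≥ 2`: at `n = 2` this is
`R(⟨2,2,2⟩) ≥ 7` (Winograd 1971 / Hopcroft–Kerr 1971), for `n ≥ 3` it follows from Bläser's
`R(⟨n,n,n⟩) ≥ 2n² + n − 2`. [cite: Blaser2003, Theorem 14] [cite: Winograd1971, Thm 3.1] -/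
theorem seven_mul_sq_le_four_mul_tensorRank (K : Type) [Field K] {n : ℕ} (hn : 2 ≤ n) :
    7 * n ^ 2 ≤ 4 * tensorRank (matMulTensor K n n n) := by
  rcases Nat.lt_or_ge n 3 with h3 | h3
  · obtain rfl : n = 2 := by omega
    have h7 := seven_le_tensorRank_matMulTensor_two K
    omega
  · have hB := blaser2003_thm14_holds K n n h3 le_rfl
    rw [show 2 * n * n = 2 * (n * n) from by ring] at hB
    rw [sq]
    have h9 : 3 * 3 ≤ n * n := Nat.mul_le_mul h3 h3
    omega

/-- Real form of the floor: `(7/4) · n² ≤ R_K(⟨n,n,n⟩)`. [cite: Blaser2003, Theorem 14] -/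
theorem sevenFourths_mul_sq_le_tensorRank (K : Type) [Field K] {n : ℕ} (hn : 2 ≤ n) :
    (7 / 4 : ℝ) * (n : ℝ) ^ 2 ≤ (tensorRank (matMulTensor K n n n) : ℝ) := by
  have h := seven_mul_sq_le_four_mul_tensorRank K hn
  have h' : ((7 * n ^ 2 : ℕ) : ℝ) ≤ ((4 * tensorRank (matMulTensor K n n n) : ℕ) : ℝ) := by
    exact_mod_cast h
  push_cast at h'
  linarith

/-! ## 2. Reach: a format certifying exponent `τ` has size at least `(7/4)^{1/(τ-2)}` -/

/-- If `R_K(⟨n,n,n⟩) ≤ n^τ` with `n ≥ 2` then `7/4 ≤ n^{τ−2}`. [cite: Blaser2003, Theorem 14] -/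
theorem sevenFourths_le_rpow_of_rank_le_rpow (K : Type) [Field K] {n : ℕ} (hn : 2 ≤ n) {τ : ℝ}
    (h : (tensorRank (matMulTensor K n n n) : ℝ) ≤ (n : ℝ) ^ τ) :
    (7 / 4 : ℝ) ≤ (n : ℝ) ^ (τ - 2) := by
  have hn0 : (0 : ℝ) < n := by exact_mod_cast (lt_of_lt_of_le zero_lt_two hn)
  have hfloor := sevenFourths_mul_sq_le_tensorRank K hn
  have hsplit : (n : ℝ) ^ τ = (n : ℝ) ^ (τ - 2) * (n : ℝ) ^ (2 : ℕ) := by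
    rw [← Real.rpow_natCast (n : ℝ) 2, ← Real.rpow_add hn0]
    norm_num
  have hsq : (0 : ℝ) < (n : ℝ) ^ (2 : ℕ) := pow_pos hn0 2
  have hmain : (7 / 4 : ℝ) * (n : ℝ) ^ 2 ≤ (n : ℝ) ^ (τ - 2) * (n : ℝ) ^ (2 : ℕ) := by
    rw [← hsplit]; exact hfloor.trans h
  by_contra hlt
  push Not at hlt
  have : (n : ℝ) ^ (τ - 2) * (n : ℝ) ^ (2 : ℕ) < (7 / 4 : ℝ) * (n : ℝ) ^ 2 :=
    mul_lt_mul_of_pos_right hlt hsq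
  linarith

/-- **No format certifies `τ ≤ 2`.** If `R_K(⟨n,n,n⟩) ≤ n^τ` with `n ≥ 2` then `τ > 2` (over every
field). [cite: Blaser2003, Theorem 14] [cite: Blaser2013, Thm 5.9] -/
theorem two_lt_of_rank_le_rpow (K : Type) [Field K] {n : ℕ} (hn : 2 ≤ n) {τ : ℝ}
    (h : (tensorRank (matMulTensor K n n n) : ℝ) ≤ (n : ℝ) ^ τ) : 2 < τ := by
  have h74 := sevenFourths_le_rpow_of_rank_le_rpow K hn h
  have hn1 : (1 : ℝ) ≤ n := by exact_mod_cast (le_trans one_le_two hn)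
  by_contra hle
  push Not at hle
  have hmono : (n : ℝ) ^ (τ - 2) ≤ (n : ℝ) ^ (0 : ℝ) :=
    Real.rpow_le_rpow_of_exponent_le hn1 (by linarith)
  rw [Real.rpow_zero] at hmono
  linarith

/-- **Reach.** If `R_K(⟨n,n,n⟩) ≤ n^τ` with `n ≥ 2` then `(7/4)^{1/(τ−2)} ≤ n`: a single format
certifying the exponent `τ` over any field has size at least `(7/4)^{1/(τ−2)}`, which is unbounded as
`τ → 2`. [cite: Blaser2003, Theorem 14] [cite: Blaser2013, Thm 5.9] -/
theorem reach_le_of_rank_le_rpow (K : Type) [Field K] {n : ℕ} (hn : 2 ≤ n) {τ : ℝ}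
    (h : (tensorRank (matMulTensor K n n n) : ℝ) ≤ (n : ℝ) ^ τ) :
    (7 / 4 : ℝ) ^ (1 / (τ - 2)) ≤ (n : ℝ) := by
  have h74 := sevenFourths_le_rpow_of_rank_le_rpow K hn h
  have hτ := two_lt_of_rank_le_rpow K hn h
  have hn0 : (0 : ℝ) ≤ n := by positivity
  have hexp : (0 : ℝ) ≤ 1 / (τ - 2) := div_nonneg zero_le_one (by linarith)
  calc (7 / 4 : ℝ) ^ (1 / (τ - 2)) ≤ ((n : ℝ) ^ (τ - 2)) ^ (1 / (τ - 2)) :=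
        Real.rpow_le_rpow (by norm_num) h74 hexp
    _ = (n : ℝ) ^ ((τ - 2) * (1 / (τ - 2))) := by rw [← Real.rpow_mul hn0]
    _ = (n : ℝ) := by rw [mul_one_div_cancel (by linarith : τ - 2 ≠ 0), Real.rpow_one]

/-- A real lower bound `c^{e} ≤ n` with `c > 1`, `e > 0` forces `n ≥ 2`. -/
theorem two_le_of_rpow_le {c e : ℝ} (hc : 1 < c) (he : 0 < e) {n : ℕ} (h : c ^ e ≤ (n : ℝ)) :
    2 ≤ n := by
  have h1 : (1 : ℝ) < c ^ e := Real.one_lt_rpow hc he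
  have hn : (1 : ℝ) < (n : ℝ) := lt_of_lt_of_le h1 h
  have : 1 < n := by exact_mod_cast hn
  omega

/-! ## 3. The two-sided witness window for K′ -/

/-- **K′ in the window.** For every transfer horizon `B`: `EventualTransfer` (item 30790) holds iff for
every `ε > 0`, for infinitely many primes `p`, a near-optimal witness `R_{𝔽̄_p}(⟨n,n,n⟩) ≤ n^{ω_p+ε}`
exists at a format `n` with `(7/4)^{1/(ω_p+ε−2)} ≤ n` (reach) and `B n ≤ p` (horizon).
[cite: BurgisserClausenShokrollahi1997, Cor. (15.18)] [cite: Blaser2003, Theorem 14] -/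
theorem eventualTransfer_iff_witness_in_window (B : ℕ → ℕ)
    (hB : ∀ (n r p : ℕ) [Fact p.Prime], B n ≤ p →
      tensorRank (matMulTensor (AlgebraicClosure (ZMod p)) n n n) ≤ r →
        tensorRank (matMulTensor ℂ n n n) ≤ r) :
    EventualTransfer ↔
      (∀ ε : ℝ, 0 < ε → ∀ p₀ : ℕ, ∃ (p : ℕ) (_ : Fact p.Prime), p₀ ≤ p ∧ ∃ n : ℕ,
        (7 / 4 : ℝ) ^ (1 / (omega (AlgebraicClosure (ZMod p)) + ε - 2)) ≤ (n : ℝ) ∧ B n ≤ p ∧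
        (tensorRank (matMulTensor (AlgebraicClosure (ZMod p)) n n n) : ℝ) ≤
          (n : ℝ) ^ (omega (AlgebraicClosure (ZMod p)) + ε)) := by
  unfold EventualTransfer
  rw [eventualTransfer_iff_witness_below_horizon B hB]
  constructor
  · intro hW ε hε p₀
    obtain ⟨p, inst, hp, n, hn2, hBn, hrank⟩ := hW ε hε p₀
    refine ⟨p, inst, hp, n, ?_, hBn, hrank⟩
    have h := reach_le_of_rank_le_rpow (AlgebraicClosure (ZMod p)) hn2 hrank
    simpa [add_sub_assoc] using h
  · intro hW ε hε p₀
    obtain ⟨p, inst, hp, n, hreach, hBn, hrank⟩ := hW ε hε p₀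
    refine ⟨p, inst, hp, n, ?_, hBn, hrank⟩
    have hω := omega_two_le (AlgebraicClosure (ZMod p))
    exact two_le_of_rpow_le (by norm_num) (by exact div_pos one_pos (by linarith)) hreach

/-- **Reach under W.** If `ω(𝔽̄_p) ≤ 2 + ε` for all large `p` (W, item 18040), the lower end of the
window is `p`-free: for every transfer horizon `B`, K′ holds iff for every `ε > 0`, for infinitely many
primes `p`, a near-optimal witness exists at a format `n ≥ (7/4)^{1/(2ε)}` with `B n ≤ p`.  For the
bridge to bite at precision `ε` the finite range must therefore reach format `(7/4)^{1/(2ε)}`.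
[cite: BurgisserClausenShokrollahi1997, Cor. (15.18)] [cite: Blaser2003, Theorem 14] -/
theorem eventualTransfer_iff_witness_reach_of_fast (hW : LargeCharacteristicFast) (B : ℕ → ℕ)
    (hB : ∀ (n r p : ℕ) [Fact p.Prime], B n ≤ p →
      tensorRank (matMulTensor (AlgebraicClosure (ZMod p)) n n n) ≤ r →
        tensorRank (matMulTensor ℂ n n n) ≤ r) :
    EventualTransfer ↔
      (∀ ε : ℝ, 0 < ε → ∀ p₀ : ℕ, ∃ (p : ℕ) (_ : Fact p.Prime), p₀ ≤ p ∧ ∃ n : ℕ,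
        (7 / 4 : ℝ) ^ (1 / (2 * ε)) ≤ (n : ℝ) ∧ B n ≤ p ∧
        (tensorRank (matMulTensor (AlgebraicClosure (ZMod p)) n n n) : ℝ) ≤
          (n : ℝ) ^ (omega (AlgebraicClosure (ZMod p)) + ε)) := by
  rw [eventualTransfer_iff_witness_in_window B hB]
  constructor
  · intro h ε hε p₀
    obtain ⟨p₁, hp₁⟩ := hW ε hε
    obtain ⟨p, inst, hp, n, hreach, hBn, hrank⟩ := h ε hε (max p₀ p₁)
    refine ⟨p, inst, (le_max_left _ _).trans hp, n, ?_, hBn, hrank⟩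
    have hωp : omega (AlgebraicClosure (ZMod p)) ≤ 2 + ε := @hp₁ p inst ((le_max_right _ _).trans hp)
    have hω2 := omega_two_le (AlgebraicClosure (ZMod p))
    have hpos : 0 < omega (AlgebraicClosure (ZMod p)) + ε - 2 := by linarith
    have hle : omega (AlgebraicClosure (ZMod p)) + ε - 2 ≤ 2 * ε := by linarith
    have hexp : 1 / (2 * ε) ≤ 1 / (omega (AlgebraicClosure (ZMod p)) + ε - 2) :=
      one_div_le_one_div_of_le hpos hle
    calc (7 / 4 : ℝ) ^ (1 / (2 * ε)) ≤ (7 / 4 : ℝ) ^ (1 / (omega (AlgebraicClosure (ZMod p)) + ε - 2)) :=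
          Real.rpow_le_rpow_of_exponent_le (by norm_num) hexp
      _ ≤ n := hreach
  · intro h ε hε p₀
    obtain ⟨p, inst, hp, n, hreach, hBn, hrank⟩ := h ε hε p₀
    refine ⟨p, inst, hp, n, ?_, hBn, hrank⟩
    have hn2 : 2 ≤ n := two_le_of_rpow_le (by norm_num) (by positivity) hreach
    have h' := reach_le_of_rank_le_rpow (AlgebraicClosure (ZMod p)) hn2 hrank
    simpa [add_sub_assoc] using h'

/-! ## 4. Formats with horizon zero: no sporadic rank drop at `⟨2,2,2⟩`, `⟨2,2,3⟩`, `⟨2,2,4⟩` -/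

/-- `R_{𝔽̄_p}(⟨2,2,2⟩) = R_ℂ(⟨2,2,2⟩)` (both `= 7`) for EVERY prime `p`.
[cite: Winograd1971, Thm 3.1] [cite: Strassen1969] -/
theorem rank_222_charFree (p : ℕ) [Fact p.Prime] :
    tensorRank (matMulTensor (AlgebraicClosure (ZMod p)) 2 2 2) = tensorRank (matMulTensor ℂ 2 2 2) := by
  have h : ∀ (K : Type) [Field K], tensorRank (matMulTensor K 2 2 2) = 7 := fun K _ =>
    le_antisymm (tensorRank_matMulTensor_two_le_seven K) (seven_le_tensorRank_matMulTensor_two K)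
  rw [h, h]

/-- `R_{𝔽̄_p}(⟨2,2,3⟩) = R_ℂ(⟨2,2,3⟩)` (both `= 11`) for EVERY prime `p`.
[cite: Alekseyev1985, main theorem (zbMATH 0577.68059)] -/
theorem rank_223_charFree (p : ℕ) [Fact p.Prime] :
    tensorRank (matMulTensor (AlgebraicClosure (ZMod p)) 2 2 3) = tensorRank (matMulTensor ℂ 2 2 3) := by
  rw [alekseyev1985_tensorRank_matMulTensor_223' (AlgebraicClosure (ZMod p)),
    alekseyev1985_tensorRank_matMulTensor_223' ℂ]

/-- `R_{𝔽̄_p}(⟨2,2,4⟩) = R_ℂ(⟨2,2,4⟩)` (both `= 14`) for EVERY prime `p`.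
[cite: AlekseevSmirnov2013, Thm 1 (zbMATH 1317.68061)] -/
theorem rank_224_charFree (p : ℕ) [Fact p.Prime] :
    tensorRank (matMulTensor (AlgebraicClosure (ZMod p)) 2 2 4) = tensorRank (matMulTensor ℂ 2 2 4) := by
  rw [alekseevSmirnov2013_tensorRank_matMulTensor_224' (AlgebraicClosure (ZMod p)),
    alekseevSmirnov2013_tensorRank_matMulTensor_224' ℂ]

/-- Consequently a `SporadicRankDrop` (item 18045) does not occur at the formats `⟨2,2,2⟩`, `⟨2,2,3⟩`,
`⟨2,2,4⟩`, in any characteristic. [cite: Alekseyev1985, main theorem] [cite: AlekseevSmirnov2013, Thm 1] -/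
theorem no_rankDrop_22n_small (p : ℕ) [Fact p.Prime] (n : ℕ) (hn : n = 2 ∨ n = 3 ∨ n = 4) :
    ¬ tensorRank (matMulTensor (AlgebraicClosure (ZMod p)) 2 2 n) < tensorRank (matMulTensor ℂ 2 2 n) := by
  rcases hn with rfl | rfl | rfl
  · rw [rank_222_charFree p]; exact lt_irrefl _
  · rw [rank_223_charFree p]; exact lt_irrefl _
  · rw [rank_224_charFree p]; exact lt_irrefl _

end Summit.MatrixMultiplication.MatrixMultiplication.Theorems.CharacteristicContinuityWitnessReach

end
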